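import Literature.IUT.LogVolume.PacketMonomialBox
import HarnessLib

/-!
# The monomial box at TOTALLY RAMIFIED slots of PAIRWISE COPRIME degrees: `(R_I)^∼` = Box is stable under every factorwise
# isometry — one WILD slot allowed

abc-iut cell, seat abc-iut-E-t58 (gen 5; rung LADDER-ABC:A2.RESCUE.J, R-J row Y-29b, «MIXED slot fields»).  PROOF-ONLY sequel of this seat's
`PacketMonomialBox.lean` (Box ⊆ `(R_I)^∼` always; Box stable under factorwise contractions of dominated bases; incongruent monomial norms
⟹ `(R_I)^∼` = Box ⟹ `(⊗g_i)((R_I)^∼) = (R_I)^∼`); no definition, no `Prop` fact, no `sorry`.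

* `incongruent_of_coprime` — Chinese remainder: if `r_i^{n_i} = p⁻¹` with the `n_i` pairwise coprime, the monomials `∏_i r_i^{a_i}`
  (`a_i < n_i`) are pairwise incongruent mod `p^ℤ`.
* `exists_basis_eq_pow` — `‖π‖^{[K:ℚ_p]} = p⁻¹` (total ramification, `π` a uniformiser) ⟹ `(π^a)_{a<[K:ℚ_p]}` is a `ℚ_p`-basis of `K`.
* **`congr_image_normalizedPacket_eq_of_coprime_finrank`** / **`…_of_coprime_absRamificationIdx`** — slots totally ramified
  (`‖π_i‖^{[k_i:ℚ_p]} = p⁻¹`, equivalently `e_i = [k_i:ℚ_p]`) of PAIRWISE COPRIME degrees ⟹ every factorwise `ℚ_p`-linear isometry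
  maps `(R_I)^∼` onto itself — NO tameness hypothesis.  Since coprimality lets at most one `e_i` be divisible by `p`, the new class is
  ONE WILD slot ⊗ tamely totally ramified slots of coprime indices (plus `ℚ_p`-slots).  Located MIXED cells (tree currency):
  `ℚ_3(∛3) ⊗ ℚ_3(√3)` (wild ⊗ tame-ramified, `p` odd) and `ℚ_2(√2) ⊗ ℚ_2(∛2)` (dyadic non-residual-class ⊗ tame) are STABLE although the
  first slots carry two-slot movers of record at `K ⊗ K` (p454126 `WildCubicIsometryMover`, p457999 `WildQuadraticIsometryMover`):
  for MIXED slot fields «some slot bad ∧ another slot ramified» is NOT the mover criterion (complementing lane 2's «bad ⊗ unramified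
  STABLE» of the Y-29b word, E-plan 2026-08-27 02:00:47Z).

Honest scope: equal or non-coprime indices (the IUT equal-slot shape `K_w ⊗ ⋯ ⊗ K_w`) are NOT decided here; residue degrees `f_i > 1` are
outside the incongruence hypothesis.  Nothing here is disputed mathematics; the [IUTchIV] locators record the cell's typing of the packet
notation. [cite: Mochizuki2012, IUTchIV Prop. 1.1 p. 9] [cite: WeilBNT1967, Ch. II §1, Prop. 3] [cite: NeukirchANT1999, Ch. II (4.8)]
-/

noncomputable section

open Module
open scoped Pointwise

namespace Literature.IUT.LogVolume

namespace MonomialBox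

/-! ## §4 Totally ramified slots of pairwise coprime degrees -/

section Coprime

variable {p : ℕ} [hp : Fact p.Prime]

/-- **Chinese remainder for monomial norms.**  If `r_i^{n_i} = p⁻¹` (`r_i = ‖π_i‖`, `n_i = [k_i:ℚ_p] = e_i`) with the `n_i` PAIRWISE COPRIME,
the monomial norms `∏_i r_i^{a_i}` (`a_i < n_i`) are pairwise incongruent mod `p^ℤ`: raising `∏ r_i^{a_i} = p^N·∏ r_i^{a'_i}` to the power
`M = ∏ n_i` gives `Σ_i (a'_i − a_i)·M/n_i = N·M`; mod `n_i` (which divides `M` and `M/n_j` for `j ≠ i`, and is prime to `M/n_i`) this is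
`n_i ∣ a'_i − a_i`, i.e. `a_i = a'_i`. [cite: NeukirchANT1999, Ch. II (4.8)] -/
theorem incongruent_of_coprime {I : Type} [Fintype I] [DecidableEq I] (n : I → ℕ)
    (hcop : Pairwise fun i j => (n i).Coprime (n j)) (r : I → ℝ) (hr : ∀ i, r i ^ n i = (p : ℝ)⁻¹) (J J' : Π i, Fin (n i)) (hJ : J ≠ J') (N : ℤ) :
    ∏ i, r i ^ (J i : ℕ) ≠ (p : ℝ) ^ N * ∏ i, r i ^ (J' i : ℕ) := by
  classical
  intro h
  have hp0 : (0 : ℝ) < p := by exact_mod_cast hp.out.pos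
  -- `M = ∏ n_i`, `M_i = ∏_{j ≠ i} n_j`, `n_i · M_i = M`
  set M : ℕ := ∏ i, n i with hM
  set Mi : I → ℕ := fun i => ∏ j ∈ Finset.univ.erase i, n j with hMi
  have hnM : ∀ i, n i * Mi i = M := fun i => Finset.mul_prod_erase Finset.univ n (Finset.mem_univ i)
  -- raise `h` to the power `M`
  have hpowM : ∀ (K : Π i, Fin (n i)), (∏ i, r i ^ (K i : ℕ)) ^ M = (p : ℝ) ^ (-((∑ i, (K i : ℕ) * Mi i : ℕ) : ℤ)) := by
    intro K
    rw [← Finset.prod_pow, zpow_neg, zpow_natCast, ← inv_pow, ← Finset.prod_pow_eq_pow_sum]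
    refine Finset.prod_congr rfl fun i _ => ?_
    rw [← pow_mul, ← hnM i, show (K i : ℕ) * (n i * Mi i) = n i * ((K i : ℕ) * Mi i) by ring, pow_mul, hr i]
  have hM' : (∏ i, r i ^ (J i : ℕ)) ^ M = ((p : ℝ) ^ N * ∏ i, r i ^ (J' i : ℕ)) ^ M := by rw [h]
  rw [mul_pow, hpowM J, hpowM J', ← zpow_natCast ((p : ℝ) ^ N) M, ← zpow_mul, ← zpow_add₀ hp0.ne'] at hM'
  have hexp : (-((∑ i, (J i : ℕ) * Mi i : ℕ) : ℤ)) = N * M + -((∑ i, (J' i : ℕ) * Mi i : ℕ) : ℤ) :=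
    zpow_right_injective₀ hp0 (by exact_mod_cast hp.out.one_lt.ne') hM'
  -- the integer identity `Σ_i (J'_i − J_i)·M_i = N·M`
  have hsum : ∑ i, ((J' i : ℕ) - (J i : ℕ) : ℤ) * (Mi i : ℤ) = N * M := by
    have e1 : ∑ i, ((J' i : ℕ) - (J i : ℕ) : ℤ) * (Mi i : ℤ) =
        (((∑ i, (J' i : ℕ) * Mi i : ℕ) : ℤ)) - (((∑ i, (J i : ℕ) * Mi i : ℕ) : ℤ)) := by
      push_cast
      rw [← Finset.sum_sub_distrib]
      exact Finset.sum_congr rfl fun i _ => by ring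
    rw [e1]
    linarith
  -- reduce mod `n i₀`
  apply hJ
  funext i₀
  have hdvdM : (n i₀ : ℤ) ∣ (M : ℤ) := by
    exact_mod_cast Finset.dvd_prod_of_mem n (Finset.mem_univ i₀)
  have hdvdMi : ∀ j, j ≠ i₀ → (n i₀ : ℤ) ∣ (Mi j : ℤ) := fun j hj => by
    exact_mod_cast Finset.dvd_prod_of_mem n (Finset.mem_erase.mpr ⟨hj.symm, Finset.mem_univ i₀⟩)
  have hcopi : IsCoprime (n i₀ : ℤ) (Mi i₀ : ℤ) := by
    rw [Nat.isCoprime_iff_coprime]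
    exact Nat.Coprime.prod_right fun j hj => hcop (Finset.mem_erase.mp hj).1.symm
  have hsplit := Finset.add_sum_erase Finset.univ (fun i => ((J' i : ℕ) - (J i : ℕ) : ℤ) * (Mi i : ℤ)) (Finset.mem_univ i₀)
  rw [hsum] at hsplit
  have hrest : (n i₀ : ℤ) ∣ ∑ i ∈ Finset.univ.erase i₀, ((J' i : ℕ) - (J i : ℕ) : ℤ) * (Mi i : ℤ) :=
    Finset.dvd_sum fun j hj => Dvd.dvd.mul_left (hdvdMi j (Finset.mem_erase.mp hj).1) _
  have hterm : (n i₀ : ℤ) ∣ ((J' i₀ : ℕ) - (J i₀ : ℕ) : ℤ) * (Mi i₀ : ℤ) := by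
    have h3 : ((J' i₀ : ℕ) - (J i₀ : ℕ) : ℤ) * (Mi i₀ : ℤ) =
        N * M - ∑ i ∈ Finset.univ.erase i₀, ((J' i : ℕ) - (J i : ℕ) : ℤ) * (Mi i : ℤ) := by linarith
    rw [h3]
    exact dvd_sub (Dvd.dvd.mul_left hdvdM N) hrest
  have hd : (n i₀ : ℤ) ∣ ((J' i₀ : ℕ) - (J i₀ : ℕ) : ℤ) := hcopi.dvd_of_dvd_mul_right hterm
  have hlt1 := (J i₀).isLt
  have hlt2 := (J' i₀).isLt
  have h0 := Int.eq_zero_of_abs_lt_dvd hd (by rw [abs_lt]; constructor <;> omega)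
  exact Fin.ext (by omega)

variable {K : Type} [NontriviallyNormedField K] [NormedAlgebra ℚ_[p] K] [IsUltrametricDist K] [ProperSpace K]

/-- **The power basis of a totally ramified slot.**  If `‖π‖^{[K:ℚ_p]} = p⁻¹` (`ord(π) = 1/[K:ℚ_p]`: `K/ℚ_p` totally ramified, `π` a
uniformiser) then `1, π, …, π^{[K:ℚ_p]−1}` is a `ℚ_p`-basis of `K`: the norms `‖π‖^a` are pairwise incongruent mod `p^ℤ` (one-slot
`incongruent_of_coprime`), so the powers are linearly independent (§0), and there are `[K:ℚ_p]` of them. [cite: WeilBNT1967, Ch. II §1, Prop. 3] -/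
theorem exists_basis_eq_pow {π : K} (hπ : ‖π‖ ^ Module.finrank ℚ_[p] K = (p : ℝ)⁻¹) :
    ∃ b : Basis (Fin (Module.finrank ℚ_[p] K)) ℚ_[p] K, ∀ a, b a = π ^ (a : ℕ) := by
  classical
  haveI : FiniteDimensional ℚ_[p] K := finiteDimensional p K
  have hn : 0 < Module.finrank ℚ_[p] K := Module.finrank_pos
  have hπ0 : π ≠ 0 := by
    intro h0
    rw [h0, norm_zero, zero_pow hn.ne'] at hπ
    exact (inv_ne_zero (by exact_mod_cast hp.out.ne_zero : (p : ℝ) ≠ 0)) hπ.symm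
  -- incongruence of the norms `‖π‖^a`, via the one-slot case of `incongruent_of_coprime`
  have hinc : ∀ a a' : Fin (Module.finrank ℚ_[p] K), a ≠ a' → ∀ N : ℤ,
      ‖π ^ (a : ℕ)‖ ≠ (p : ℝ) ^ N * ‖π ^ (a' : ℕ)‖ := by
    intro a a' hne N h
    rw [norm_pow, norm_pow] at h
    refine incongruent_of_coprime (I := Unit) (fun _ => Module.finrank ℚ_[p] K)
      (fun i j hij => absurd (Subsingleton.elim i j) hij) (fun _ => ‖π‖) (fun _ => hπ)
      (fun _ => a) (fun _ => a') (fun heq => hne (congr_fun heq ())) N ?_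
    simpa using h
  have hli : LinearIndependent ℚ_[p] (fun a : Fin (Module.finrank ℚ_[p] K) => π ^ (a : ℕ)) := by
    refine Fintype.linearIndependent_iff.mpr fun c hc a => ?_
    have hle := norm_smul_le_norm_sum_of_incongruent (p := p) (fun a : Fin (Module.finrank ℚ_[p] K) => π ^ (a : ℕ)) hinc c a
    rw [hc, norm_zero] at hle
    have h0 : c a • π ^ (a : ℕ) = 0 := norm_le_zero_iff.mp hle
    exact (smul_eq_zero.mp h0).resolve_right (pow_ne_zero _ hπ0)
  have hsp : ⊤ ≤ Submodule.span ℚ_[p] (Set.range fun a : Fin (Module.finrank ℚ_[p] K) => π ^ (a : ℕ)) :=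
    (hli.span_eq_top_of_card_eq_finrank' (by rw [Fintype.card_fin])).ge
  exact ⟨Basis.mk hli hsp, fun a => by rw [Basis.coe_mk]⟩

variable (p) {I : Type} [Fintype I] [DecidableEq I]
  (k : I → Type) [∀ i, NontriviallyNormedField (k i)] [∀ i, NormedAlgebra ℚ_[p] (k i)]
  [∀ i, IsUltrametricDist (k i)] [∀ i, ProperSpace (k i)]

/-- **Totally ramified slots of PAIRWISE COPRIME degrees: `(⊗_i g_i)((R_I)^∼) = (R_I)^∼` for ALL factorwise `ℚ_p`-linear isometries —
no tameness hypothesis.**  Hypotheses: `π_i ∈ k_i` with `‖π_i‖^{[k_i:ℚ_p]} = p⁻¹` (`k_i/ℚ_p` totally ramified, `e_i = [k_i:ℚ_p]`, `π_i` a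
uniformiser) and `[k_i:ℚ_p]`, `[k_j:ℚ_p]` coprime for `i ≠ j`.  Then the power bases have incongruent monomial norms (`incongruent_of_coprime`),
`(R_I)^∼` is the monomial box `{Σ c_a ⊗π_i^{a_i} : ‖c_a‖ ≤ p^{Σ a_i/e_i}}` and §3 applies.  Coprimality lets at most one `e_i` be divisible
by `p`: ONE WILD slot tensored with totally (tamely) ramified slots of coprime indices — e.g. `ℚ_3(∛3) ⊗ ℚ_3(√3)`, `ℚ_2(√2) ⊗ ℚ_2(∛2)` —
is STABLE. [cite: Mochizuki2012, IUTchIV Prop. 1.1 p. 9] [cite: WeilBNT1967, Ch. II §1, Prop. 3] [cite: NeukirchANT1999, Ch. II (4.8)] -/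
theorem congr_image_normalizedPacket_eq_of_coprime_finrank [Nonempty I] (π : Π i, k i)
    (hπ : ∀ i, ‖π i‖ ^ Module.finrank ℚ_[p] (k i) = (p : ℝ)⁻¹)
    (hcop : Pairwise fun i j => (Module.finrank ℚ_[p] (k i)).Coprime (Module.finrank ℚ_[p] (k j)))
    (g : ∀ i, k i ≃ₗ[ℚ_[p]] k i) (hg : ∀ i x, ‖g i x‖ = ‖x‖) :
    (PiTensorProduct.congr g : PacketAlgebra p k ≃ₗ[ℚ_[p]] PacketAlgebra p k) ''
        (normalizedPacket p k : Set (PacketAlgebra p k)) = normalizedPacket p k := by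
  classical
  choose b hb using fun i => exists_basis_eq_pow (p := p) (hπ i)
  refine congr_image_normalizedPacket_eq_of_incongruent p k b ?_ g hg
  intro J J' hJ N
  simp_rw [hb, norm_pow]
  exact incongruent_of_coprime (fun i => Module.finrank ℚ_[p] (k i)) hcop (fun i => ‖π i‖) hπ J J' hJ N

open Literature.NumberTheory.GaloisRepresentations.Ultrametric in
/-- The same in the tree's ramification vocabulary: **if every slot is TOTALLY RAMIFIED (`e_i = [k_i:ℚ_p]`, `absRamificationIdx`) with the
`e_i` pairwise coprime, every factorwise `ℚ_p`-linear isometry maps `(R_I)^∼` onto itself** (`π_i` a norm uniformiser: `‖ϖ_i‖^{e_i} = p⁻¹`,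
`norm_pow_absRamificationIdx`). [cite: Mochizuki2012, IUTchIV Prop. 1.1 p. 9] [cite: NeukirchANT1999, Ch. II (4.8)] -/
theorem congr_image_normalizedPacket_eq_of_coprime_absRamificationIdx [Nonempty I]
    (htot : ∀ i, absRamificationIdx p (k i) = Module.finrank ℚ_[p] (k i))
    (hcop : Pairwise fun i j => (absRamificationIdx p (k i)).Coprime (absRamificationIdx p (k j)))
    (g : ∀ i, k i ≃ₗ[ℚ_[p]] k i) (hg : ∀ i x, ‖g i x‖ = ‖x‖) :
    (PiTensorProduct.congr g : PacketAlgebra p k ≃ₗ[ℚ_[p]] PacketAlgebra p k) ''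
        (normalizedPacket p k : Set (PacketAlgebra p k)) = normalizedPacket p k := by
  choose ϖ hϖ using fun i => exists_isUniformizer (F := k i)
  refine congr_image_normalizedPacket_eq_of_coprime_finrank p k (fun i => (ϖ i : k i)) (fun i => ?_) ?_ g hg
  · rw [← htot i]
    exact norm_pow_absRamificationIdx p (k i) (hϖ i)
  · intro i j hij
    rw [← htot i, ← htot j]
    exact hcop hij

end Coprime

end MonomialBox

end Literature.IUT.LogVolume

end
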